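import Summits.BirchSwinnertonDyer.Rank1Residual.X2.RankOneSplitSwitchDisplay155aLocal
import HarnessLib

/-!
# Row B11 ∩ SPLIT — the ÉTALE-SWITCH PILOT at the class `155a` (`p = 5`), part 2 (THE DISPLAY):
# `BSD(E, 5)` for every curve of the class from PUBLISHED facts + Keller–Yin's IMC at ONE curve + two
# per-class inputs; the `5`-isogeny, its degree, the étale direction, the reduction types, the Galois
# side and the local datum are part 1 (`X2/RankOneSplitSwitchDisplay155aLocal.lean`), IN THE KERNEL
# (cell `bsd-eis`, seat `bsd-eis-cgshw` g9; route `EisensteinPrimes`, crux 4 `BSDpOnCellC` =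
# stmt-BirchSwinnertonDyer-19034, line b1 skeleton v7, stub `stub_ctlOrSwitch`; RULINGS L14 (c) / L15
# AMENDMENT «the per-pair switch pilot (C) may proceed with the DD15 fact as a binder»; THEOREMS ONLY)

HONEST FRAMING (cell `bsd-eis`, run/shared/lean/pub/bsd-eis/): theorems only; nothing booked; X2 stays
CONSTRUCTION-SHAPED; no label or count moves; `BSD` is not proved for any curve unconditionally — the
display is CONDITIONAL on the named facts below (one of them, Keller–Yin Thm. 5.1.3, a PREPRINT).

`bsdp_of_isIsogenous_155a1_at_five`: for every globally minimal `W ∼ 155a1 = [0, −1, 1, 10, 6]`,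
`BSD(W, 5)` from — [PUB, registered named facts] the 23 facts of `stub_publishedFacts` used by the split
road + cas-split `hCS` (`thm210_thm211_bdpDisplay_pNew`) + Tate uniformisation `hT hT'` + Ogg–Saito in
Galois form `hOS` + the DD15/Stevens Manin transport `hDS` (`X2.dokchitserStevens_maninDatum_of_pIsogeny`,
cited fact p436778, cell referee W-g16-2 pending); [PRE] `h3 : SplitIMCEqOnTreeInt W₁ 5` = Keller–Yin
Thm. 5.1.3 at the ONE curve `W₁ = [0, −1, 1, −840, −9114]`; [per class, instrument] `hr : r_an(W₁) = 1`
(Cremona allbsd; PARI) and `hMan₀ : HasPrimeToManinDatum 155a1 5` (`155a1` is `X₀(155)`-optimal with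
Manin constant `1`, Cremona; class-wide = Mazur at the optimal curve). ROAD: the ψ-even split pointwise
theorem at `W₁` (`bsdp_of_cellCSplitNotGV_of_manin_of_pNewValue_of_imcInt_of_ctl`, p442183: value half
FROM PRINT, partner in the closed sub-cell X2a), CTL-split the THEOREM
`splitControlOnTree_of_cellC_of_noPadicPTorsion` since `W₁(ℚ_5)[5] = 0`, Manin datum transported along
the certified `φ` by `hasPrimeToManinDatum_of_pIsogeny`, Cassels back. NO c1s, NO c2s, NO crux 3, NO CTL
input, NO Schneider — the switch disjunct of `stub_ctlOrSwitch` EXHIBITED on a real class. What this is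
NOT: not a booking; `N = 155 < 5000` (a pilot of the mechanism); Keller–Yin's IMC stays PRE.

References: [DokchitserDokchitser2015LocalInvariants] Prop. 4.10, Thm. 8.2, Thm. A.1; [Stevens1989] (2.2);
[Castella2018Exceptional] Thms. 2.10–2.11; [KellerYin2024] Thm. 5.1.3 (PRE); [CastellaEtAl2021] Thm. 5.3.1;
[GreenbergVatsal2000] Thm. (1.3); [SilvermanATAEC1994] IV.10–11, V.5.3–5.4; [MilneADT2006] I.7.3;
[Mazur1978] Cor. 4.1; [Miller2011LMS] Def. 1.1; Cremona ecdata 155a.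
-/

set_option autoImplicit false

noncomputable section

open scoped Classical MatrixGroups ModularForm

open Polynomial CongruenceSubgroup WeierstrassCurve NumberField IsDedekindDomain Field
  Literature.NumberTheory.EllipticCurves Literature.NumberTheory.EllipticCurves.PolyCert
  Literature.NumberTheory.EllipticCurves.GreenbergSelmer
  Literature.NumberTheory.EllipticCurves.ModularForms Literature.NumberTheory.QuadraticFields
  Literature.NumberTheory.EllipticCurves.Rank1Residual
  Literature.NumberTheory.EllipticCurves.Rank1Residual.Typed
  Literature.NumberTheory.EllipticCurves.KrizLi2019
  Literature.NumberTheory.EllipticCurves.GreenbergVatsal2000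
  Literature.NumberTheory.EllipticCurves.Wuthrich2014
  Literature.NumberTheory.EllipticCurves.SteinWuthrich2013
  Literature.NumberTheory.EllipticCurves.Castella2018
  Literature.NumberTheory.EllipticCurves.Castella2018Exceptional
  Literature.NumberTheory.GaloisRepresentations Literature.NumberTheory.GaloisCohomology
  Literature.NumberTheory.Automorphic
  Summit.BirchSwinnertonDyer.BirchSwinnertonDyer.Rank1Residual.IntModel
  Summit.BirchSwinnertonDyer.BirchSwinnertonDyer.Rank1Residual.X11RankOne
  Summit.BirchSwinnertonDyer.Rank1Residual.X11b.AcSelmer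
  Summit.BirchSwinnertonDyer.Rank1Residual.X11b.Halves
  Summit.BirchSwinnertonDyer.Rank1Residual.X11b
  Summit.BirchSwinnertonDyer.Rank1Residual

namespace Summit.BirchSwinnertonDyer.Rank1Residual.X2.RankOneSplitSwitchDisplay155a

/-! ## §5 The display: `BSD(E, 5)` on the class `155a` by the étale switch -/

/-- **THE SWITCH PILOT — `BSD(E, 5)` for every globally minimal `E` in the `ℚ`-isogeny class of
`155a1`.** INPUTS: [PUB, registered named facts, by name] GV 2000 λ/μ `hGV`, Wuthrich 2014 Thm 16 `hWu`,
Stein–Wuthrich 2013 `hJs hJn hHs hHn`, modular parametrisation `hpar`, Greenberg–Stevens `hGS`, newforms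
`hnf`, Poitou–Tate ×2 `hPT hPT2`, local Euler–Poincaré `hEP`, cd ≤ 2 `hcd`, Brink `hBr`, Hsieh 2014 Thm 1
`hH`, cas-split Thms 2.10–2.11 `hCS`, Gross–Zagier `hGZ`, Kolyvagin `hKo`, Heegner rationality `hHP`,
rank = analytic rank `hGZK`, Hoffstein–Luo `hHL`, Cassels `hCassels`, Tate uniformisation `hT hT'`,
Ogg–Saito in Galois form `hOS`, and the DD15/Stevens Manin transport `hDS` (cited fact p436778, cell
referee W-g16-2 pending); [PRE] `h3 : SplitIMCEqOnTreeInt W₁ 5` — Keller–Yin Thm. 5.1.3 at the ONE curve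
`W₁ = [0, −1, 1, −840, −9114]`; [per class, instrument] `hr : r_an(W₁) = 1` (Cremona allbsd; PARI
`ellanalyticrank(155a1) = 1`, `L′(1) = 1.5149`) and `hMan₀ : HasPrimeToManinDatum 155a1 5` (`155a1` is
`X₀(155)`-optimal with Manin constant `1`, Cremona; = Mazur's theorem at the optimal curve). IN THE KERNEL:
everything else (§1–§4). ROAD: the Manin datum passes to `W₁` along the certified `5`-isogeny `φ`
(`hasPrimeToManinDatum_of_pIsogeny`: degree `5`, `W₀` multiplicative, `v_5 j(W₀) = 5·v_5 j(W₁)`,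
`N(W₁) = N(W₀)` by Ogg–Saito); `W₁(ℚ_5)[5] = 0` (`5 ∤ v_5 Δ_min(W₁) = 1`), so CTL-split at `W₁` is the
THEOREM `splitControlOnTree_of_cellC_of_noPadicPTorsion`; `(W₁, 5)` is a ψ-even split X2c pair, so
`bsdp_of_cellCSplitNotGV_of_manin_of_pNewValue_of_imcInt_of_ctl` (value half FROM PRINT, partner in the
closed sub-cell X2a) gives `BSD(W₁, 5)`; Cassels transports it to every `E ∼ 155a1`. NO c1s, NO c2s, NO
crux 3, NO CTL input, NO Schneider hypothesis. CONDITIONAL on the listed binders; nothing booked.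
[cite: DokchitserDokchitser2015LocalInvariants, Prop. 4.10 (p. 4348), Thm. 8.2 (p. 4353), Thm. A.1 (p. 4354)]
[cite: Stevens1989, §2 Lemma (2.2)] [cite: Castella2018Exceptional, Thm. 2.10 and Thm. 2.11 (arXiv:1507.04260 pp. 13–14)]
[claim: KellerYin2024, status: under-review] [cite: Castella2018, Thm. 2.3 (arXiv:1704.06608 p. 5)]
[cite: MilneADT2006, Thm. I.7.3] [cite: GreenbergVatsal2000, Thm. (1.3) and §2 p. 28]
[cite: SilvermanATAEC1994, Exercise 4.40 with §IV.10 and Thm. IV.11.1] [cite: Miller2011LMS, Def. 1.1] -/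
theorem bsdp_of_isIsogenous_155a1_at_five
    (hGV : lambdaMu_multiplicative_of_gvPar) (hWu : thm16_charIdeal_dvd_multiplicative_of_reducible)
    (hJs : thm61_splitMultiplicative) (hJn : thm61_nonsplitMultiplicative)
    (hHs : exists_isSplitMultCanonical) (hHn : exists_isMultCanonical)
    (hpar : nonempty_modularParametrizationData)
    (hGS : ∀ (W : WeierstrassCurve ℚ) [W.IsElliptic] [W.IsGloballyMinimal] (p : ℕ) [Fact p.Prime],
      greenberg_stevens (W := W) (p := p))
    (hnf : exists_isNewformOf)
    (hPT : ∀ (K : Type) [Field K] [NumberField K], poitouTate_selmerStructure_duality K)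
    (hPT2 : ∀ (K : Type) [Field K] [NumberField K], poitouTate_sha_tateDual K)
    (hEP : ∀ (K : Type) [Field K] [NumberField K] (v : HeightOneSpectrum (𝓞 K)),
      localEulerPoincareCharacteristic (v.adicCompletion K))
    (hcd : fieldCdLE_two_of_numberField)
    (hBr : ∀ (K : Type) [Field K] [NumberField K] (p : ℕ) [Fact p.Prime],
      ZpExtension.decomp_not_le_kerSubgroup_of_isAnticyclotomic K p)
    (hH : hsieh2014_exists_anticyclotomicPAdicLFunction) (hCS : thm210_thm211_bdpDisplay_pNew)
    (hGZ : ∀ (N : ℕ) [NeZero N] (W : WeierstrassCurve ℚ) (K : Type) [Field K] [NumberField K],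
      gross_zagier N W K)
    (hKo : ∀ (N : ℕ) [NeZero N] (W : WeierstrassCurve ℚ) (K : Type) [Field K] [NumberField K],
      kolyvagin N W K)
    (hHP : ∀ (N : ℕ) [NeZero N] (W : WeierstrassCurve ℚ) (K : Type) [Field K] [NumberField K],
      heegnerPointComplex_mem_range_map N W K)
    (hGZK : rank_eq_analyticRank_of_analyticRank_le_one) (hHL : HoffsteinLuo1997_exists_twist_L_one_ne_zero)
    (hCassels : bsdRHS_eq_of_isIsogenous)
    (hT : Silverman1994_thmV53_tateUniformisation.{0}) (hT' : Silverman1994_thmV53_corV54_tateUniformisation.{0})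
    (hOS : ∀ (W : WeierstrassCurve ℚ) (ℓ : ℕ) [Fact ℓ.Prime],
      W.artinConductorExponent_tate_eq_conductorExponent_of_isElliptic ℓ)
    (hDS : dokchitserStevens_maninDatum_of_pIsogeny)
    [Fact (Nat.Prime 5)]
    (hr : (⟨0, -1, 1, -840, -9114⟩ : WeierstrassCurve ℚ).analyticRank = 1)
    (hMan₀ : HasPrimeToManinDatum (⟨0, -1, 1, 10, 6⟩ : WeierstrassCurve ℚ) 5)
    (h3 : ∀ [(⟨0, -1, 1, -840, -9114⟩ : WeierstrassCurve ℚ).IsElliptic]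
      [(⟨0, -1, 1, -840, -9114⟩ : WeierstrassCurve ℚ).IsGloballyMinimal],
      SplitIMCEqOnTreeInt (⟨0, -1, 1, -840, -9114⟩ : WeierstrassCurve ℚ) 5)
    (W : WeierstrassCurve ℚ) [W.IsElliptic] [W.IsGloballyMinimal]
    (hW : IsIsogenous W (⟨0, -1, 1, 10, 6⟩ : WeierstrassCurve ℚ)) : BSDp W 5 := by
  haveI := isElliptic_W₀
  haveI := isGloballyMinimal_W₀
  haveI := isElliptic_W₁
  haveI := isGloballyMinimal_W₁
  have hmod : hasEntireLFunction_rat := hasEntireLFunction_rat_of_exists_isNewformOf hnf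
  have hiso : IsIsogenous (⟨0, -1, 1, 10, 6⟩ : WeierstrassCurve ℚ) ⟨0, -1, 1, -840, -9114⟩ :=
    ⟨isogeny155a⟩
  obtain ⟨hX₁, hngv₁⟩ := classX2_and_not_gvPar_W₁ hT hT'
  have hc₁ : CellC (⟨0, -1, 1, -840, -9114⟩ : WeierstrassCurve ℚ) 5 := ⟨hr, hX₁⟩
  -- the Manin datum passes along the étale `5`-isogeny (DD15/Stevens), conductor by Ogg–Saito
  have hMan₁ : HasPrimeToManinDatum (⟨0, -1, 1, -840, -9114⟩ : WeierstrassCurve ℚ) 5 :=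
    hasPrimeToManinDatum_of_pIsogeny hDS hMan₀ isogeny155a degree_isogeny155a split_W₀.1
      padicValRat_j_W₀_W₁ (conductorNorm_eq_of_isIsogenous_of_tate hOS _ _ hiso).symm
  -- no `ℚ_5`-rational `5`-torsion at the étale end, hence CTL-split is a theorem there
  have h0 : ∀ Q₀ : ((⟨0, -1, 1, -840, -9114⟩ : WeierstrassCurve ℚ).baseChange ℚ_[5]).toAffine.Point,
      5 • Q₀ = 0 → Q₀ = 0 :=
    X11b.LocalTorsion.localTorsion_eq_zero_of_mult _ 5 (by norm_num) split_W₁.1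
      (Or.inr not_dvd_val_minimalDiscriminant_W₁)
  have hCTL₁ : SplitControlOnTree (⟨0, -1, 1, -840, -9114⟩ : WeierstrassCurve ℚ) 5 :=
    splitControlOnTree_of_cellC_of_noPadicPTorsion _ 5 hGZK hnf hPT hPT2 hEP hcd hBr hc₁ h0
  -- the ψ-even split road at `W₁`: value half FROM PRINT, partner closed, NO crux 3
  have hb₁ : BSDp (⟨0, -1, 1, -840, -9114⟩ : WeierstrassCurve ℚ) 5 :=
    bsdp_of_cellCSplitNotGV_of_manin_of_pNewValue_of_imcInt_of_ctl _ 5 hGV hWu hJs hJn hHs hHn hpar hGS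
      hnf hH hCS hGZ hKo hHP hGZK hHL (by norm_num) ⟨hc₁, split_W₁.2, hngv₁⟩ hMan₁ h3 hCTL₁
  -- Cassels back to any curve of the class
  exact bsdp_of_isIsogenous_of_bsdp hCassels hGZK hmod _ W (hW.trans' hiso).symm_of_charZero 5
    (by rw [hc₁.1]) hb₁

/-- **In particular `BSD(155a1, 5)` and `BSD(W₁, 5)`** under the same inputs. [cite: Miller2011LMS, Def. 1.1]
[claim: KellerYin2024, status: under-review] [cite: DokchitserDokchitser2015LocalInvariants, Prop. 4.10] -/
theorem bsdp_155a1_and_quotient_at_five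
    (hGV : lambdaMu_multiplicative_of_gvPar) (hWu : thm16_charIdeal_dvd_multiplicative_of_reducible)
    (hJs : thm61_splitMultiplicative) (hJn : thm61_nonsplitMultiplicative)
    (hHs : exists_isSplitMultCanonical) (hHn : exists_isMultCanonical)
    (hpar : nonempty_modularParametrizationData)
    (hGS : ∀ (W : WeierstrassCurve ℚ) [W.IsElliptic] [W.IsGloballyMinimal] (p : ℕ) [Fact p.Prime],
      greenberg_stevens (W := W) (p := p))
    (hnf : exists_isNewformOf)
    (hPT : ∀ (K : Type) [Field K] [NumberField K], poitouTate_selmerStructure_duality K)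
    (hPT2 : ∀ (K : Type) [Field K] [NumberField K], poitouTate_sha_tateDual K)
    (hEP : ∀ (K : Type) [Field K] [NumberField K] (v : HeightOneSpectrum (𝓞 K)),
      localEulerPoincareCharacteristic (v.adicCompletion K))
    (hcd : fieldCdLE_two_of_numberField)
    (hBr : ∀ (K : Type) [Field K] [NumberField K] (p : ℕ) [Fact p.Prime],
      ZpExtension.decomp_not_le_kerSubgroup_of_isAnticyclotomic K p)
    (hH : hsieh2014_exists_anticyclotomicPAdicLFunction) (hCS : thm210_thm211_bdpDisplay_pNew)
    (hGZ : ∀ (N : ℕ) [NeZero N] (W : WeierstrassCurve ℚ) (K : Type) [Field K] [NumberField K],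
      gross_zagier N W K)
    (hKo : ∀ (N : ℕ) [NeZero N] (W : WeierstrassCurve ℚ) (K : Type) [Field K] [NumberField K],
      kolyvagin N W K)
    (hHP : ∀ (N : ℕ) [NeZero N] (W : WeierstrassCurve ℚ) (K : Type) [Field K] [NumberField K],
      heegnerPointComplex_mem_range_map N W K)
    (hGZK : rank_eq_analyticRank_of_analyticRank_le_one) (hHL : HoffsteinLuo1997_exists_twist_L_one_ne_zero)
    (hCassels : bsdRHS_eq_of_isIsogenous)
    (hT : Silverman1994_thmV53_tateUniformisation.{0}) (hT' : Silverman1994_thmV53_corV54_tateUniformisation.{0})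
    (hOS : ∀ (W : WeierstrassCurve ℚ) (ℓ : ℕ) [Fact ℓ.Prime],
      W.artinConductorExponent_tate_eq_conductorExponent_of_isElliptic ℓ)
    (hDS : dokchitserStevens_maninDatum_of_pIsogeny)
    [Fact (Nat.Prime 5)]
    (hr : (⟨0, -1, 1, -840, -9114⟩ : WeierstrassCurve ℚ).analyticRank = 1)
    (hMan₀ : HasPrimeToManinDatum (⟨0, -1, 1, 10, 6⟩ : WeierstrassCurve ℚ) 5)
    (h3 : ∀ [(⟨0, -1, 1, -840, -9114⟩ : WeierstrassCurve ℚ).IsElliptic]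
      [(⟨0, -1, 1, -840, -9114⟩ : WeierstrassCurve ℚ).IsGloballyMinimal],
      SplitIMCEqOnTreeInt (⟨0, -1, 1, -840, -9114⟩ : WeierstrassCurve ℚ) 5) :
    (haveI := isElliptic_W₀; haveI := isGloballyMinimal_W₀
     BSDp (⟨0, -1, 1, 10, 6⟩ : WeierstrassCurve ℚ) 5) ∧
    (haveI := isElliptic_W₁; haveI := isGloballyMinimal_W₁
     BSDp (⟨0, -1, 1, -840, -9114⟩ : WeierstrassCurve ℚ) 5) := by
  haveI := isElliptic_W₀
  haveI := isGloballyMinimal_W₀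
  haveI := isElliptic_W₁
  haveI := isGloballyMinimal_W₁
  have hiso : IsIsogenous (⟨0, -1, 1, 10, 6⟩ : WeierstrassCurve ℚ) ⟨0, -1, 1, -840, -9114⟩ :=
    ⟨isogeny155a⟩
  exact ⟨bsdp_of_isIsogenous_155a1_at_five hGV hWu hJs hJn hHs hHn hpar hGS hnf hPT hPT2 hEP hcd hBr hH
      hCS hGZ hKo hHP hGZK hHL hCassels hT hT' hOS hDS hr hMan₀ h3 _ (IsIsogenous.refl_holds _),
    bsdp_of_isIsogenous_155a1_at_five hGV hWu hJs hJn hHs hHn hpar hGS hnf hPT hPT2 hEP hcd hBr hH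
      hCS hGZ hKo hHP hGZK hHL hCassels hT hT' hOS hDS hr hMan₀ h3 _ hiso.symm_of_charZero⟩

end Summit.BirchSwinnertonDyer.Rank1Residual.X2.RankOneSplitSwitchDisplay155a

end
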